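import Mathlib
import Summits.CriticalPhenomena.PercolationContinuityZ3.Theorems.PercNearOneGluingNoHeavyLowerTailSahiCombFiveUpSetRank
import Summits.CriticalPhenomena.PercolationContinuityZ3.Theorems.PercNearOneGluingNoHeavyLowerTailSahiCombTriWTranslate

/-!
# The TRANSLATE-RANK LEMMA: zeta functions indexed by the antipode of an up-set form a basis on EVERY translate of that up-set

Support file of the one-cut programme (crux `NoHeavyLowerTail`, stmt-CriticalPhenomena-4575; lemma factory `prim-lf-1`, gen 32;
memo `FROM-prim-lf-1-gen32-TRANSLATE-RANK.md`).  Self-contained linear algebra over `ℚ` on the cube `Finset α` with the antipode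
`refl` (`…SahiCombFiveUpSet`) and the translates `transl a 𝒜 = {s ∆ a | s ∈ 𝒜}` of P5's symmetric master form (`…SahiCombTriWTranslate`).

P5's (SYM) programme (memo `FROM-prim-masterthm-p5-g18-SYMMETRIC-MASTER-FORM.md` §4, §6, §8) asks for the "tree's ±1 tools extended to zeta
conditions on a TRANSLATED up-set".  This file is that extension.  For an up-set `W` and ANY translate `s`:

* `sum_powerset_sdiff_neg_one_pow_card_zeta` — the face identity `Σ_{e ⊆ d \ s} (-1)^{#e} [e ∪ (d ∩ s) ⊆ t] = [d ∩ s ⊆ t]·[(d \ s) ∩ t = ∅]`;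
* `not_face_of_compl_not_mem` — if `dᶜ ∉ W` and `t ∆ s ∈ W` then NOT (`d ∩ s ⊆ t` and `(d \ s) ∩ t = ∅`);
* **`exists_support_coef_transl`** (SUPPORT LEMMA on a translate) — on `transl s W` the zeta function `t ↦ [d ⊆ t]` of ANY `d` is a
  `ℚ`-combination of zeta functions of sets `e` with `eᶜ ∈ W` and `d ∩ s ⊆ e ⊆ d` (strong induction on `d`, peeling the top term off the
  face identity, which vanishes on `transl s W` when `dᶜ ∉ W`); for `s = ∅` this is `exists_support_coef` of `…SahiCombFiveUpSetRank`;
* **`linearIndependent_zeta_refl_transl`** (TRANSLATE-RANK LEMMA) — the restricted zeta functions `t ↦ [e ⊆ t]` (`t ∈ transl s W`), indexed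
  by `e ∈ refl W`, are linearly independent in `ℚ^{transl s W}`, hence a basis (`#(transl s W) = #W = #(refl W)`); `s = ∅` is the antipodal
  basis C1 (`linearIndependent_zeta_refl`), `s = univ` is the unitriangular zeta matrix of `refl W`;
* **`eq_zero_of_zeta_sum_eq_zero_transl`** — the same in coefficient form (the form used downstream);
* **`card_inter_refl_le_card_inter_transl`** — the counting corollary, P5's TRANSLATE LEMMA `#(h ∩ refl U) ≤ #(h ∩ transl s U)` for up-sets
  `h, U` and every `s` (a Kleitman lemma interpolating `s = ∅` (Kleitman) and `s = univ` (identity)): the rows indexed by `d ∈ h` are supported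
  on columns in `h`, so they stay independent after restriction to `h`, and their number is at most the dimension.
HONEST LABEL: elementary lemmas, all proved, std axioms; nothing here proves `TranslateIneq` / `TriWIneq`. [this work]
-/

namespace Summit.CriticalPhenomena.PercolationContinuityZ3.Theorems

namespace FiveUpSet

open Finset
open scoped symmDiff

variable {α : Type} [DecidableEq α] [Fintype α]

/-! ### Translates: cardinality -/

omit [Fintype α] in
/-- A translate has the cardinality of the family. [this work] -/
theorem card_transl (a : Finset α) (𝒜 : Finset (Finset α)) : (transl a 𝒜).card = 𝒜.card := by
  unfold transl
  rw [card_map]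

/-! ### The face identity and its vanishing on a translate -/

omit [Fintype α] in
/-- The FACE IDENTITY: `Σ_{e ⊆ d \ s} (-1)^{#e} [e ∪ (d ∩ s) ⊆ t] = [d ∩ s ⊆ t] · [(d \ s) ∩ t = ∅]` — the indicator of the face of the cube
"coordinates of `d ∩ s` equal to 1, coordinates of `d \ s` equal to 0" as an alternating sum of zeta functions of the sets between `d ∩ s` and `d`.
[folklore] -/
theorem sum_powerset_sdiff_neg_one_pow_card_zeta (d s t : Finset α) :
    ∑ e ∈ (d \ s).powerset, (-1 : ℚ) ^ e.card * (if e ∪ (d ∩ s) ⊆ t then (1 : ℚ) else 0)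
      = if (d ∩ s ⊆ t ∧ (d \ s) ∩ t = ∅) then 1 else 0 := by
  have key : ∀ e ∈ (d \ s).powerset, (-1 : ℚ) ^ e.card * (if e ∪ (d ∩ s) ⊆ t then (1 : ℚ) else 0)
      = ((-1 : ℚ) ^ e.card * (if e ⊆ t then (1 : ℚ) else 0)) * (if d ∩ s ⊆ t then (1 : ℚ) else 0) := by
    intro e _
    by_cases h1 : e ⊆ t <;> by_cases h2 : d ∩ s ⊆ t <;> simp [h1, h2, union_subset_iff]
  rw [sum_congr rfl key, ← sum_mul, sum_powerset_neg_one_pow_card_zeta (d \ s) t]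
  by_cases h1 : (d \ s) ∩ t = ∅ <;> by_cases h2 : d ∩ s ⊆ t <;> simp [h1, h2]

/-- If `W` is an up-set, `dᶜ ∉ W` and `t` lies in the translate `transl s W` (i.e. `t ∆ s ∈ W`), then `t` is NOT in the face
"`d ∩ s ⊆ t` and `(d \ s) ∩ t = ∅`" (otherwise `t ∆ s ⊆ dᶜ`, forcing `dᶜ ∈ W`). [this work] -/
theorem not_face_of_compl_not_mem {W : Finset (Finset α)} (hW : IsUpperSet (W : Set (Finset α)))
    {d s t : Finset α} (hd : dᶜ ∉ W) (ht : t ∈ transl s W) : ¬ (d ∩ s ⊆ t ∧ (d \ s) ∩ t = ∅) := by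
  rintro ⟨h1, h2⟩
  apply hd
  have hts : t ∆ s ∈ W := mem_transl.1 ht
  have hsub : t ∆ s ⊆ dᶜ := by
    intro x hx
    rw [mem_compl]
    intro hxd
    rw [mem_symmDiff] at hx
    rcases hx with ⟨hxt, hxs⟩ | ⟨hxs, hxt⟩
    · have hx' : x ∈ (d \ s) ∩ t := mem_inter.2 ⟨mem_sdiff.2 ⟨hxd, hxs⟩, hxt⟩
      rw [h2] at hx'
      simp at hx'
    · exact hxt (h1 (mem_inter.2 ⟨hxd, hxs⟩))
  exact hW hsub hts

/-! ### The support lemma on a translate -/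

/-- **SUPPORT LEMMA ON A TRANSLATE** (coefficient form).  For an up-set `W`, any `s` and any `d` there are coefficients `c e`, non-zero
only for `e` with `eᶜ ∈ W` and `d ∩ s ⊆ e ⊆ d`, such that `[d ⊆ t] = Σ_e c e · [e ⊆ t]` for every `t ∈ transl s W`; when `dᶜ ∈ W` one may
(and we do) take `c = δ_d`.  Proof: strong induction on `d`; if `dᶜ ∉ W` the face identity vanishes on `transl s W`
(`not_face_of_compl_not_mem`) and expresses `[d ⊆ t]` there through the sets `e ∪ (d ∩ s)`, `e ⊊ d \ s`. [this work] -/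
theorem exists_support_coef_transl {W : Finset (Finset α)} (hW : IsUpperSet (W : Set (Finset α))) (s d : Finset α) :
    ∃ c : Finset α → ℚ, (dᶜ ∈ W → c = fun e => if e = d then 1 else 0) ∧
      (∀ e, c e ≠ 0 → eᶜ ∈ W ∧ e ⊆ d ∧ d ∩ s ⊆ e) ∧
      ∀ t ∈ transl s W, (if d ⊆ t then (1 : ℚ) else 0) = ∑ e, c e * (if e ⊆ t then (1 : ℚ) else 0) := by
  induction d using Finset.strongInduction with
  | H d ih =>
    by_cases hd : dᶜ ∈ W
    · refine ⟨fun e => if e = d then 1 else 0, fun _ => rfl, ?_, ?_⟩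
      · intro e he
        by_cases hed : e = d
        · subst hed
          exact ⟨hd, Finset.Subset.refl _, inter_subset_left⟩
        · simp [hed] at he
      · intro t _
        simp only [ite_mul, one_mul, zero_mul, Finset.sum_ite_eq', Finset.mem_univ, if_true]
    · have ih' : ∀ e', e' ⊂ d → ∃ c : Finset α → ℚ, (∀ x, c x ≠ 0 → xᶜ ∈ W ∧ x ⊆ e' ∧ e' ∩ s ⊆ x) ∧
          ∀ t ∈ transl s W, (if e' ⊆ t then (1 : ℚ) else 0) = ∑ x, c x * (if x ⊆ t then (1 : ℚ) else 0) := by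
        intro e' he'
        obtain ⟨c, -, hc1, hc2⟩ := ih e' he'
        exact ⟨c, hc1, hc2⟩
      choose! c hc using ih'
      have hmem : ∀ e, e ∈ (d \ s).powerset.erase (d \ s) → e ∪ (d ∩ s) ⊂ d := by
        intro e he
        rw [mem_erase, mem_powerset] at he
        refine Finset.ssubset_iff_subset_ne.2 ⟨union_subset (he.2.trans sdiff_subset) inter_subset_left, ?_⟩
        intro heq
        apply he.1
        refine Finset.Subset.antisymm he.2 ?_
        intro x hx
        have hxd : x ∈ d := (mem_sdiff.1 hx).1
        have hxs : x ∉ s := (mem_sdiff.1 hx).2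
        rw [← heq, mem_union] at hxd
        rcases hxd with h | h
        · exact h
        · exact absurd (mem_inter.1 h).2 hxs
      refine ⟨fun x => ∑ e ∈ (d \ s).powerset.erase (d \ s),
          (-((-1 : ℚ) ^ (d \ s).card * (-1 : ℚ) ^ e.card)) * c (e ∪ (d ∩ s)) x, fun h => absurd h hd, ?_, ?_⟩
      · intro x hx
        obtain ⟨e, he, hne⟩ := Finset.exists_ne_zero_of_sum_ne_zero hx
        have hed : e ∪ (d ∩ s) ⊂ d := hmem e he
        have hcx : c (e ∪ (d ∩ s)) x ≠ 0 := right_ne_zero_of_mul hne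
        obtain ⟨hxW, hxe, hsx⟩ := (hc _ hed).1 x hcx
        refine ⟨hxW, hxe.trans hed.subset, Finset.Subset.trans ?_ hsx⟩
        intro y hy
        exact mem_inter.2 ⟨mem_union_right _ hy, (mem_inter.1 hy).2⟩
      · intro t ht
        have hz := sum_powerset_sdiff_neg_one_pow_card_zeta d s t
        rw [if_neg (not_face_of_compl_not_mem hW hd ht)] at hz
        rw [← Finset.add_sum_erase _ _ (mem_powerset_self (d \ s))] at hz
        rw [sdiff_union_inter] at hz
        have hsq : (-1 : ℚ) ^ (d \ s).card * (-1 : ℚ) ^ (d \ s).card = 1 := by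
          rw [← mul_pow]
          norm_num
        have step1 : (if d ⊆ t then (1 : ℚ) else 0)
            = ∑ e ∈ (d \ s).powerset.erase (d \ s),
                (-((-1 : ℚ) ^ (d \ s).card * (-1 : ℚ) ^ e.card)) * (if e ∪ (d ∩ s) ⊆ t then (1 : ℚ) else 0) := by
          calc (if d ⊆ t then (1 : ℚ) else 0)
              = ((-1 : ℚ) ^ (d \ s).card * (-1 : ℚ) ^ (d \ s).card) * (if d ⊆ t then (1 : ℚ) else 0) := by
                  rw [hsq, one_mul]
            _ = (-1 : ℚ) ^ (d \ s).card *
                  (-(∑ e ∈ (d \ s).powerset.erase (d \ s),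
                      (-1 : ℚ) ^ e.card * (if e ∪ (d ∩ s) ⊆ t then (1 : ℚ) else 0))) := by
                  rw [mul_assoc, eq_neg_of_add_eq_zero_left hz]
            _ = ∑ e ∈ (d \ s).powerset.erase (d \ s),
                  (-((-1 : ℚ) ^ (d \ s).card * (-1 : ℚ) ^ e.card)) * (if e ∪ (d ∩ s) ⊆ t then (1 : ℚ) else 0) := by
                  rw [mul_neg, Finset.mul_sum, ← Finset.sum_neg_distrib]
                  refine sum_congr rfl fun e _ => ?_
                  ring
        rw [step1]
        have step2 : ∀ e ∈ (d \ s).powerset.erase (d \ s),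
            (-((-1 : ℚ) ^ (d \ s).card * (-1 : ℚ) ^ e.card)) * (if e ∪ (d ∩ s) ⊆ t then (1 : ℚ) else 0)
              = ∑ x, (-((-1 : ℚ) ^ (d \ s).card * (-1 : ℚ) ^ e.card)) * c (e ∪ (d ∩ s)) x
                  * (if x ⊆ t then (1 : ℚ) else 0) := by
          intro e he
          rw [(hc _ (hmem e he)).2 t ht, Finset.mul_sum]
          refine sum_congr rfl fun x _ => ?_
          ring
        rw [sum_congr rfl step2, Finset.sum_comm]
        refine sum_congr rfl fun x _ => ?_
        rw [Finset.sum_mul]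

/-! ### The translate-rank lemma -/

/-- **TRANSLATE-RANK LEMMA.**  For an up-set `W` of the cube and ANY `s`, the restricted zeta functions `t ↦ [e ⊆ t]` (`t ∈ transl s W`),
indexed by `e ∈ refl W` (i.e. `eᶜ ∈ W`), are linearly independent in `ℚ^{transl s W}` — hence a basis, as `#(refl W) = #W = #(transl s W)`.
`s = ∅`: the antipodal basis C1; `s = univ`: the unitriangular zeta matrix of the down-set `refl W`.  Proof: they span (support lemma on a
translate + `indicator_mem_span_zeta`) and their number is the dimension. [this work] -/
theorem linearIndependent_zeta_refl_transl {W : Finset (Finset α)} (hW : IsUpperSet (W : Set (Finset α))) (s : Finset α) :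
    LinearIndependent ℚ
      (fun e : ↥(refl W) => fun u : ↥(transl s W) => if (e : Finset α) ⊆ (u : Finset α) then (1 : ℚ) else 0) := by
  apply linearIndependent_of_top_le_span_of_card_eq_finrank
  · rintro f -
    rw [pi_eq_sum_univ f]
    refine Submodule.sum_mem _ fun u _ => Submodule.smul_mem _ _ ?_
    have h1 : (fun j : ↥(transl s W) => if u = j then (1 : ℚ) else 0)
        = (fun j : ↥(transl s W) => if (j : Finset α) = (u : Finset α) then (1 : ℚ) else 0) := by
      funext j
      by_cases h : u = j
      · subst h; simp
      · have h' : ¬ (j : Finset α) = (u : Finset α) := fun h'' => h (Subtype.ext h''.symm)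
        simp [h, h']
    rw [h1]
    refine (Submodule.span_le.mpr ?_) (indicator_mem_span_zeta (transl s W) (u : Finset α))
    rintro _ ⟨d, rfl⟩
    obtain ⟨c, -, hc, hct⟩ := exists_support_coef_transl hW s d
    have hsum : (fun u : ↥(transl s W) => if d ⊆ (u : Finset α) then (1 : ℚ) else 0)
        = ∑ e ∈ refl W, c e • (fun u : ↥(transl s W) => if e ⊆ (u : Finset α) then (1 : ℚ) else 0) := by
      funext u
      rw [hct u u.2, Finset.sum_apply]
      simp only [Pi.smul_apply, smul_eq_mul]
      refine (Finset.sum_subset (subset_univ _) ?_).symm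
      intro e _ he
      have h0 : c e = 0 := by
        by_contra hne
        exact he (mem_refl.2 (hc e hne).1)
      rw [h0, zero_mul]
    change (fun u : ↥(transl s W) => if d ⊆ (u : Finset α) then (1 : ℚ) else 0) ∈ _
    rw [hsum]
    exact Submodule.sum_mem _ fun e he => Submodule.smul_mem _ _ (Submodule.subset_span ⟨⟨e, he⟩, rfl⟩)
  · rw [Fintype.card_coe, card_refl, Module.finrank_fintype_fun_eq_card, Fintype.card_coe, card_transl]

/-- **Translate-rank lemma in coefficient form.**  If `W` is an up-set, `g` vanishes off `refl W` (i.e. `g e ≠ 0 → eᶜ ∈ W`) and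
`Σ_e g e · [e ⊆ t] = 0` for every `t ∈ transl s W`, then `g = 0`. [this work] -/
theorem eq_zero_of_zeta_sum_eq_zero_transl {W : Finset (Finset α)} (hW : IsUpperSet (W : Set (Finset α))) (s : Finset α)
    (g : Finset α → ℚ) (hg : ∀ e, g e ≠ 0 → eᶜ ∈ W)
    (h : ∀ t ∈ transl s W, ∑ e, g e * (if e ⊆ t then (1 : ℚ) else 0) = 0) : ∀ e, g e = 0 := by
  have hli := linearIndependent_zeta_refl_transl hW s
  have hrel : ∑ e : ↥(refl W),
      g e • (fun u : ↥(transl s W) => if (e : Finset α) ⊆ (u : Finset α) then (1 : ℚ) else 0) = 0 := by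
    funext u
    rw [Finset.sum_apply]
    simp only [Pi.smul_apply, smul_eq_mul, Pi.zero_apply]
    rw [Finset.sum_coe_sort (refl W) (fun e => g e * (if e ⊆ (u : Finset α) then (1 : ℚ) else 0))]
    rw [Finset.sum_subset (subset_univ _) ?_]
    · exact h u u.2
    · intro e _ he
      have h0 : g e = 0 := by
        by_contra hne
        exact he (mem_refl.2 (hg e hne))
      rw [h0, zero_mul]
  have hzero := Fintype.linearIndependent_iff.1 hli (fun e => g e) hrel
  intro e
  by_contra hne
  exact hne (hzero ⟨e, mem_refl.2 (hg e hne)⟩)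

/-! ### The counting corollary: the translate lemma -/

/-- **THE TRANSLATE LEMMA** (P5, memo SYMMETRIC-MASTER-FORM §3; a Kleitman lemma for translates).  For up-sets `h, U` of a finite cube and
ANY `s`: `#(h ∩ refl U) ≤ #(h ∩ transl s U)` — inside an up-set, a translate of an up-set is at least as large as its antipodal image
(`s = ∅`: Kleitman's lemma `card_inter_refl_le`; `s = univ`: equality).  Proof: the zeta rows indexed by `d ∈ h ∩ refl U` are supported on
columns `t ⊇ d`, which lie in `h`; so after restriction to the columns `h ∩ transl s U` they are still linearly independent
(`eq_zero_of_zeta_sum_eq_zero_transl`), and their number is at most the dimension. [this work] -/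
theorem card_inter_refl_le_card_inter_transl {h U : Finset (Finset α)} (hh : IsUpperSet (h : Set (Finset α)))
    (hU : IsUpperSet (U : Set (Finset α))) (s : Finset α) : (h ∩ refl U).card ≤ (h ∩ transl s U).card := by
  have hli : LinearIndependent ℚ (fun d : ↥(h ∩ refl U) => fun t : ↥(h ∩ transl s U) =>
      if (d : Finset α) ⊆ (t : Finset α) then (1 : ℚ) else 0) := by
    rw [Fintype.linearIndependent_iff]
    intro g hg
    obtain ⟨a, ha⟩ : ∃ f : Finset α → ℚ, ∀ d, f d = if hd : d ∈ h ∩ refl U then g ⟨d, hd⟩ else 0 :=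
      ⟨_, fun _ => rfl⟩
    have hasupp : ∀ d, a d ≠ 0 → d ∈ h ∩ refl U := by
      intro d hd
      by_contra h'
      rw [ha d, dif_neg h'] at hd
      exact hd rfl
    have suma : ∀ t : Finset α, ∑ d : ↥(h ∩ refl U), g d * (if (d : Finset α) ⊆ t then (1 : ℚ) else 0)
        = ∑ d, a d * (if d ⊆ t then (1 : ℚ) else 0) := by
      intro t
      have h1 : ∑ d, a d * (if d ⊆ t then (1 : ℚ) else 0)
          = ∑ d ∈ h ∩ refl U, a d * (if d ⊆ t then (1 : ℚ) else 0) := by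
        refine (Finset.sum_subset (subset_univ _) ?_).symm
        intro d _ hd
        rw [ha d, dif_neg hd, zero_mul]
      rw [h1]
      conv_rhs => rw [← Finset.sum_coe_sort]
      refine Finset.sum_congr rfl fun d _ => ?_
      rw [ha d, dif_pos d.2]
    have E : ∀ t ∈ transl s U, ∑ d, a d * (if d ⊆ t then (1 : ℚ) else 0) = 0 := by
      intro t ht
      by_cases hth : t ∈ h
      · have h0 := congrFun hg ⟨t, mem_inter.2 ⟨hth, ht⟩⟩
        rw [Finset.sum_apply] at h0
        simp only [Pi.smul_apply, smul_eq_mul, Pi.zero_apply] at h0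
        rw [suma t] at h0
        exact h0
      · refine Finset.sum_eq_zero fun d _ => ?_
        by_cases hd : a d = 0
        · rw [hd, zero_mul]
        · have hdh : d ∈ h := (mem_inter.1 (hasupp d hd)).1
          have hdt : ¬ d ⊆ t := fun hsub => hth (hh hsub hdh)
          rw [if_neg hdt, mul_zero]
    have K := eq_zero_of_zeta_sum_eq_zero_transl hU s a
      (fun d hd => mem_refl.1 (mem_inter.1 (hasupp d hd)).2) E
    rintro ⟨d, hd⟩
    have h0 := K d
    rwa [ha d, dif_pos hd] at h0
  have hcard := hli.fintype_card_le_finrank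
  rw [Module.finrank_fintype_fun_eq_card, Fintype.card_coe, Fintype.card_coe] at hcard
  exact hcard

end FiveUpSet

end Summit.CriticalPhenomena.PercolationContinuityZ3.Theorems
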